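import Summits.CriticalPhenomena.Ising3DConformalLimit.Theorems.FKParityRobustnessDefs
import Summits.CriticalPhenomena.Ising3DConformalLimit.Theorems.FKParityRobustnessParityRobustMergingFKTransfer
import Summits.CriticalPhenomena.Ising3DConformalLimit.Theorems.FKParityRobustnessDepletionBoundHTE
import Summits.CriticalPhenomena.Ising3DConformalLimit.Theorems.IndependentStrandsJoin.Negative.GraphUniform
import Literature.Probability.LatticeModels.LoopO1
import Literature.Probability.LatticeModels.ModifiedSimonInequality
import Mathlib.Combinatorics.SimpleGraph.DeleteEdges
import HarnessLib

/-!
# Crux `IndependentStrandsJoin` (stmt-CriticalPhenomena-14625), line `pinch-to-tetra` — stub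
# `stub_perScale`, auxiliary file: forcing a `T`-join into a strand costs a constant

Route `FKParityRobustness`, sub-problem `Ising3DConformalLimit`; theorem-only support file, imported
by `FKParityRobustnessIndependentStrandsJoinStubPerScale.lean` (the stub `stub_perScale`, the
PER-SCALE form of the crux).

**What is proved (general finite graph).**  On a finite simple graph `G`, at `t = tanh β`, `β ≥ 0`,
write `Z_A(ω) = Σ_{F ∈ 𝒯_A(ω)} t^{|F|}` (`tJoins G ω A`: the edge sets `F ⊆ ω ∩ E(G)` with odd set
`A`), `Z_A = Z_A(univ) = loopO1PartitionFunction G t A`.  For every `T`-join `D ∈ 𝒯_A(univ)`: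

  `t^{2|D|} · Z_A ≤ 2^{|D|} · Σ_{F ∈ 𝒯_A(univ), F ⊇ D} t^{|F|}`        (`forcing_cost`),

i.e. under the sourced loop-O(1) measure `ℓ^A_{G,t}` the event `{F ⊇ D}` has probability at least
`(t²/2)^{|D|}` — a finite-energy bound, uniform in the graph — and its consequence
`perScale_of_forcingSet` (the registered auxiliary stub `stub_perScaleAssembly`): if a `T`-join `D` of
`{a₂, a₃}` with `|D| ≤ m` joins `a₀` to `a₂`, then `(t^{2m}/2^m) Z(a₀a₁) Z(a₂a₃)` is at most the crux's
double sum `Σ_{F₁ ∈ 𝒯(a₀a₁)} Σ_{F₂ ∈ 𝒯(a₂a₃)} t^{|F₁|+|F₂|} 1[a₀ ↔ a₂ in F₁ ∪ F₂]` (restrict to `F₂ ⊇ D`,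
where the indicator is `1`).  The forcing cost is a chain of three elementary steps:
* XOR TRANSPORT (`xor_transport_le`): `t^{|D|} Z_A ≤ Z_∅` (`F ↦ F ∆ D`, `|F ∆ D| ≤ |F| + |D|`, `t ≤ 1`);
* FINITE ENERGY (`finite_energy`): `Z_∅ ≤ 2^{|D|} Z_∅((↑D)ᶜ)` — group `F ∈ 𝒯_∅` by the trace
  `S = F ∩ D`; on a fibre `F ↦ F ∖ D` is injective into `𝒯_{∂S}((↑D)ᶜ)`, and
  `Z_{∂S}((↑D)ᶜ) ≤ Z_∅((↑D)ᶜ)` is `|⟨σ_{∂S}⟩^free| ≤ 1` for the Ising model on `G ∖ D` through the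
  high-temperature expansion (`isingCorr_free_eq_hteSum_div`, `abs_isingCorr_le_one`;
  `sum_tJoins_compl_le_empty`);
* FORCING DECOMPOSITION (`forcing_decomposition`): `Σ_{F ∈ 𝒯_A, F ⊇ D} t^{|F|} = t^{|D|} Z_{A∆A}((↑D)ᶜ)
  = t^{|D|} Z_∅((↑D)ᶜ)` (`F ↦ F ∖ D` is a bijection onto the even subgraphs avoiding `D`).

The XOR transport and forcing decomposition are ported from the kernel-checked § A″ of the standing
disprover's work file `Cruxes/IndependentStrandsJoin/Disproof.lean`
(refuter-cdisprove-stmt-CriticalPhenomena-14625-0).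

References: U. T. Hansen, J. Jiang, F. R. Klausen, arXiv:2506.10765, §2 (sourced even subgraphs,
`T`-joins, the XOR switching) [HansenJiangKlausen2025]; H. Duminil-Copin, *Random currents expansion of
the Ising model*, arXiv:1607.06933, §2.2.1 (high-temperature expansion) [DuminilCopinECM2018].
-/

noncomputable section

open Finset SimpleGraph
open Literature.Probability.LatticeModels
open Summit.CriticalPhenomena.Ising3DConformalLimit.Cruxes.ParityRobustMerging.PlaquetteXorSurgery
  (symmDiff_mem_tJoins)
open scoped Classical

namespace Summit.CriticalPhenomena.Ising3DConformalLimit.Theorems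

namespace StubPerScale

variable {V : Type*} [Fintype V] [DecidableEq V] (G : SimpleGraph V) [DecidableRel G.Adj]

/-! ### XOR transport and forcing (ported from the disprover's toolkit) -/

-- adapted from Cruxes/IndependentStrandsJoin/Disproof.lean § A″ (`card_symmDiff_le`,
-- `xor_transport_le`, `mem_tJoins_of_subset`, `forcing_decomposition`)

omit [Fintype V] in
/-- `|F ∆ P| ≤ |F| + |P|`. -/
theorem card_symmDiff_le (F P : Finset (Sym2 V)) : #(symmDiff F P) ≤ #F + #P :=
  (Finset.card_le_card (symmDiff_le_sup (a := F) (b := P))).trans (Finset.card_union_le F P)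

/-- **XOR transport inequality.**  For `0 ≤ t ≤ 1` and a `T`-join `P` of `B` inside `ω`,
`t^{|P|} · Z_A(ω) ≤ Z_{A ∆ B}(ω)`: `F ↦ F ∆ P` maps `𝒯_A(ω)` injectively into `𝒯_{A∆B}(ω)` and
`t^{|F|+|P|} ≤ t^{|F ∆ P|}`. -/
theorem xor_transport_le {t : ℝ} (ht0 : 0 ≤ t) (ht1 : t ≤ 1) {ω : Set (Sym2 V)} {A B : Finset V}
    {P : Finset (Sym2 V)} (hP : P ∈ tJoins G ω B) :
    t ^ #P * ∑ F ∈ tJoins G ω A, t ^ #F ≤ ∑ F ∈ tJoins G ω (symmDiff A B), t ^ #F := by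
  calc t ^ #P * ∑ F ∈ tJoins G ω A, t ^ #F
      = ∑ F ∈ tJoins G ω A, t ^ (#F + #P) := by
        rw [Finset.mul_sum]
        refine Finset.sum_congr rfl fun F _ => ?_
        rw [pow_add, mul_comm]
    _ ≤ ∑ F ∈ tJoins G ω A, t ^ #(symmDiff F P) :=
        Finset.sum_le_sum fun F _ => pow_le_pow_of_le_one ht0 ht1 (card_symmDiff_le F P)
    _ = ∑ F' ∈ (tJoins G ω A).image (fun F => symmDiff F P), t ^ #F' := by
        rw [Finset.sum_image]
        intro F₁ _ F₂ _ h
        simpa using congrArg (fun S => symmDiff S P) h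
    _ ≤ ∑ F ∈ tJoins G ω (symmDiff A B), t ^ #F := by
        refine Finset.sum_le_sum_of_subset_of_nonneg ?_ fun F _ _ => pow_nonneg ht0 _
        intro F' hF'
        obtain ⟨F, hF, rfl⟩ := Finset.mem_image.1 hF'
        exact symmDiff_mem_tJoins G hF hP

/-- Changing the ambient edge set `ω` of `tJoins`: only `↑F ⊆ ω` matters. -/
theorem mem_tJoins_of_subset {ω ω' : Set (Sym2 V)} {A : Finset V} {F : Finset (Sym2 V)}
    (hF : F ∈ tJoins G ω A) (hω : (↑F : Set (Sym2 V)) ⊆ ω') : F ∈ tJoins G ω' A := by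
  rw [mem_tJoins] at hF ⊢
  exact ⟨hF.1, hω, hF.2.2⟩

/-- **Forcing decomposition.**  For a `T`-join `D` of `B`, the `T`-joins of `A` CONTAINING `D` are
exactly the sets `E ∪ D`, `E` a `T`-join of `A ∆ B` avoiding the edges of `D`, and `|E ∪ D| = |E| + |D|`;
hence `Σ_{F ∈ 𝒯_A, D ⊆ F} t^{|F|} = t^{|D|} · Σ_{E ∈ 𝒯_{A∆B}((↑D)ᶜ)} t^{|E|}`. -/
theorem forcing_decomposition (t : ℝ) {A B : Finset V} {D : Finset (Sym2 V)}
    (hD : D ∈ tJoins G Set.univ B) :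
    ∑ F ∈ (tJoins G Set.univ A).filter (fun F => D ⊆ F), t ^ #F =
      t ^ #D * ∑ E ∈ tJoins G ((↑D : Set (Sym2 V))ᶜ) (symmDiff A B), t ^ #E := by
  -- the map `E ↦ E ∪ D` and its image
  have himage : (tJoins G ((↑D : Set (Sym2 V))ᶜ) (symmDiff A B)).image (fun E => E ∪ D) =
      (tJoins G Set.univ A).filter (fun F => D ⊆ F) := by
    ext F
    simp only [Finset.mem_image, Finset.mem_filter]
    constructor
    · rintro ⟨E, hE, rfl⟩
      have hEω := ((mem_tJoins G).1 hE).2.1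
      have hdisj : Disjoint E D := by
        rw [Finset.disjoint_left]
        intro e heE heD
        exact hEω (Finset.mem_coe.2 heE) (Finset.mem_coe.2 heD)
      have hE' : E ∈ tJoins G Set.univ (symmDiff A B) := mem_tJoins_of_subset G hE (Set.subset_univ _)
      have h := symmDiff_mem_tJoins G hE' hD
      rw [symmDiff_symmDiff_cancel_right, hdisj.symmDiff_eq_sup] at h
      exact ⟨h, Finset.subset_union_right⟩
    · rintro ⟨hF, hDF⟩
      refine ⟨F \ D, ?_, Finset.sdiff_union_of_subset hDF⟩
      have h := symmDiff_mem_tJoins G hF hD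
      rw [symmDiff_of_ge hDF] at h
      refine mem_tJoins_of_subset G h ?_
      intro e he
      rw [Finset.mem_coe, Finset.mem_sdiff] at he
      exact fun heD => he.2 (Finset.mem_coe.1 heD)
  have hinj : Set.InjOn (fun E : Finset (Sym2 V) => E ∪ D)
      ↑(tJoins G ((↑D : Set (Sym2 V))ᶜ) (symmDiff A B)) := by
    intro E₁ hE₁ E₂ hE₂ h
    have hω₁ := ((mem_tJoins G).1 (Finset.mem_coe.1 hE₁)).2.1
    have hω₂ := ((mem_tJoins G).1 (Finset.mem_coe.1 hE₂)).2.1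
    have hd₁ : Disjoint E₁ D := Finset.disjoint_left.2 fun e he heD =>
      hω₁ (Finset.mem_coe.2 he) (Finset.mem_coe.2 heD)
    have hd₂ : Disjoint E₂ D := Finset.disjoint_left.2 fun e he heD =>
      hω₂ (Finset.mem_coe.2 he) (Finset.mem_coe.2 heD)
    have := congrArg (fun S => S \ D) h
    simpa [Finset.union_sdiff_cancel_right, hd₁, hd₂] using this
  rw [← himage, Finset.sum_image hinj, Finset.mul_sum]
  refine Finset.sum_congr rfl fun E hE => ?_
  have hEω := ((mem_tJoins G).1 hE).2.1
  have hdisj : Disjoint E D := Finset.disjoint_left.2 fun e he heD =>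
    hEω (Finset.mem_coe.2 he) (Finset.mem_coe.2 heD)
  rw [Finset.card_union_of_disjoint hdisj, pow_add, mul_comm]

/-! ### Finite energy: deleting the edges of `D` costs at most `2^{|D|}` on `Z_∅` -/

/-- The `T`-joins of `G` avoiding the edges of `D` are the `T`-joins of the graph `G ∖ D`. -/
theorem tJoins_compl_eq (D : Finset (Sym2 V)) (A : Finset V) :
    tJoins G ((↑D : Set (Sym2 V))ᶜ) A = tJoins (G.deleteEdges (↑D : Set (Sym2 V))) Set.univ A := by
  ext F
  simp only [mem_tJoins, Set.subset_univ, true_and]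
  constructor
  · rintro ⟨hG, hω, hpar⟩
    refine ⟨fun e he => ?_, hpar⟩
    rw [SimpleGraph.mem_edgeFinset, SimpleGraph.edgeSet_deleteEdges]
    exact ⟨SimpleGraph.mem_edgeFinset.1 (hG he), hω (Finset.mem_coe.2 he)⟩
  · rintro ⟨hG', hpar⟩
    refine ⟨fun e he => ?_, fun e he => ?_, hpar⟩
    · have h := hG' he
      rw [SimpleGraph.mem_edgeFinset, SimpleGraph.edgeSet_deleteEdges] at h
      exact SimpleGraph.mem_edgeFinset.2 h.1
    · have h := hG' (Finset.mem_coe.1 he)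
      rw [SimpleGraph.mem_edgeFinset, SimpleGraph.edgeSet_deleteEdges] at h
      exact h.2

/-- **`Z_A((↑D)ᶜ) ≤ Z_∅((↑D)ᶜ)` at `t = tanh β`**: on the graph `G ∖ D` this is `|⟨σ_A⟩^free| ≤ 1`
through the high-temperature expansion `⟨σ_A⟩^free = g(A)/g(∅)`. -/
theorem sum_tJoins_compl_le_empty (β : ℝ) (D : Finset (Sym2 V)) (A : Finset V) :
    ∑ F ∈ tJoins G ((↑D : Set (Sym2 V))ᶜ) A, Real.tanh β ^ #F ≤
      ∑ F ∈ tJoins G ((↑D : Set (Sym2 V))ᶜ) ∅, Real.tanh β ^ #F := by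
  rw [tJoins_compl_eq G D A, tJoins_compl_eq G D ∅, DepletionBound.sum_tJoins_pow_eq_hteSum,
    DepletionBound.sum_tJoins_pow_eq_hteSum]
  set G' := G.deleteEdges (↑D : Set (Sym2 V))
  have hpos := hteSum_empty_pos G' Finset.univ β
  have h1 := abs_isingCorr_le_one G' Finset.univ β 0 .free A
  rw [isingCorr_free_eq_hteSum_div G' Finset.univ β (Finset.subset_univ A), abs_le] at h1
  exact (div_le_one hpos).1 h1.2

/-- `0 ≤ tanh β ≤ 1` for `β ≥ 0`. -/
theorem tanh_mem_Icc {β : ℝ} (hβ : 0 ≤ β) : 0 ≤ Real.tanh β ∧ Real.tanh β ≤ 1 := by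
  refine ⟨?_, (Real.tanh_lt_one β).le⟩
  rw [Real.tanh_eq_sinh_div_cosh]
  exact div_nonneg (Real.sinh_nonneg_iff.2 hβ) (Real.cosh_pos _).le

/-- **Finite energy.**  `Z_∅ ≤ 2^{|D|} · Z_∅((↑D)ᶜ)` at `t = tanh β`, `β ≥ 0`: group the even subgraphs
`F` by their trace `S = F ∩ D`; on a fibre, `F ↦ F ∖ D` is injective into `𝒯_{∂S}((↑D)ᶜ)`, whose mass
is at most `Z_∅((↑D)ᶜ)` (`sum_tJoins_compl_le_empty`), and there are `2^{|D|}` fibres. -/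
theorem finite_energy {β : ℝ} (hβ : 0 ≤ β) (D : Finset (Sym2 V)) :
    ∑ F ∈ tJoins G Set.univ ∅, Real.tanh β ^ #F ≤
      (2 : ℝ) ^ #D * ∑ F ∈ tJoins G ((↑D : Set (Sym2 V))ᶜ) ∅, Real.tanh β ^ #F := by
  obtain ⟨ht0, ht1⟩ := tanh_mem_Icc hβ
  set t := Real.tanh β with ht
  have hmaps : ∀ F ∈ tJoins G Set.univ (∅ : Finset V), F ∩ D ∈ D.powerset := fun F _ =>
    Finset.mem_powerset.2 Finset.inter_subset_right
  rw [← Finset.sum_fiberwise_of_maps_to hmaps]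
  have hfib : ∀ S ∈ D.powerset,
      ∑ F ∈ (tJoins G Set.univ (∅ : Finset V)).filter (fun F => F ∩ D = S), t ^ #F ≤
        ∑ F ∈ tJoins G ((↑D : Set (Sym2 V))ᶜ) ∅, t ^ #F := by
    intro S _
    calc ∑ F ∈ (tJoins G Set.univ (∅ : Finset V)).filter (fun F => F ∩ D = S), t ^ #F
        ≤ ∑ F ∈ (tJoins G Set.univ (∅ : Finset V)).filter (fun F => F ∩ D = S), t ^ #(F \ D) :=
          Finset.sum_le_sum fun F _ =>
            pow_le_pow_of_le_one ht0 ht1 (Finset.card_le_card Finset.sdiff_subset)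
      _ = ∑ E ∈ ((tJoins G Set.univ (∅ : Finset V)).filter (fun F => F ∩ D = S)).image
            (fun F => F \ D), t ^ #E := by
          rw [Finset.sum_image]
          intro F₁ h₁ F₂ h₂ h
          rw [Finset.mem_coe, Finset.mem_filter] at h₁ h₂
          have h' : F₁ \ D = F₂ \ D := h
          rw [← Finset.sdiff_union_inter F₁ D, ← Finset.sdiff_union_inter F₂ D, h', h₁.2, h₂.2]
      _ ≤ ∑ E ∈ tJoins G ((↑D : Set (Sym2 V))ᶜ) (oddDegVerts S), t ^ #E := by
          refine Finset.sum_le_sum_of_subset_of_nonneg (fun E hE => ?_) fun _ _ _ => pow_nonneg ht0 _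
          obtain ⟨F, hF, rfl⟩ := Finset.mem_image.1 hE
          rw [Finset.mem_filter] at hF
          have hSF : S ⊆ F := hF.2 ▸ Finset.inter_subset_left
          have hSG : S ⊆ G.edgeFinset := hSF.trans ((mem_tJoins G).1 hF.1).1
          have hS' : S ∈ tJoins G Set.univ (oddDegVerts S) :=
            (mem_tJoins_iff_oddDegVerts G).2 ⟨hSG, Set.subset_univ _, rfl⟩
          have h := symmDiff_mem_tJoins G hF.1 hS'
          have hFS : symmDiff F S = F \ D := by
            rw [symmDiff_of_ge hSF, ← hF.2, Finset.sdiff_inter_self_left]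
          rw [show symmDiff (∅ : Finset V) (oddDegVerts S) = oddDegVerts S from bot_symmDiff _,
            hFS] at h
          refine mem_tJoins_of_subset G h fun e he => ?_
          rw [Finset.mem_coe, Finset.mem_sdiff] at he
          exact fun heD => he.2 (Finset.mem_coe.1 heD)
      _ ≤ ∑ F ∈ tJoins G ((↑D : Set (Sym2 V))ᶜ) ∅, t ^ #F := sum_tJoins_compl_le_empty G β D _
  calc ∑ S ∈ D.powerset, ∑ F ∈ (tJoins G Set.univ (∅ : Finset V)).filter (fun F => F ∩ D = S), t ^ #F
      ≤ ∑ S ∈ D.powerset, ∑ F ∈ tJoins G ((↑D : Set (Sym2 V))ᶜ) ∅, t ^ #F := Finset.sum_le_sum hfib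
    _ = (2 : ℝ) ^ #D * ∑ F ∈ tJoins G ((↑D : Set (Sym2 V))ᶜ) ∅, t ^ #F := by
        rw [Finset.sum_const, Finset.card_powerset, nsmul_eq_mul, Nat.cast_pow, Nat.cast_ofNat]

/-! ### Forcing a `T`-join costs a constant -/

/-- **Forcing cost.**  For `β ≥ 0`, `t = tanh β` and a `T`-join `D ∈ 𝒯_A(univ)`:
`t^{2|D|} · Z_A ≤ 2^{|D|} · Σ_{F ∈ 𝒯_A, F ⊇ D} t^{|F|}` — XOR transport, finite energy and the forcing
decomposition chained. -/
theorem forcing_cost {β : ℝ} (hβ : 0 ≤ β) (A : Finset V) {D : Finset (Sym2 V)}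
    (hD : D ∈ tJoins G Set.univ A) :
    Real.tanh β ^ (2 * #D) * loopO1PartitionFunction G (Real.tanh β) A ≤
      (2 : ℝ) ^ #D * ∑ F ∈ (tJoins G Set.univ A).filter (fun F => D ⊆ F), Real.tanh β ^ #F := by
  obtain ⟨ht0, ht1⟩ := tanh_mem_Icc hβ
  set t := Real.tanh β with ht
  have hxor : t ^ #D * ∑ F ∈ tJoins G Set.univ A, t ^ #F ≤ ∑ F ∈ tJoins G Set.univ ∅, t ^ #F := by
    have h := xor_transport_le G ht0 ht1 (A := A) hD
    rwa [symmDiff_self] at h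
  have hforce : t ^ #D * ∑ E ∈ tJoins G ((↑D : Set (Sym2 V))ᶜ) ∅, t ^ #E =
      ∑ F ∈ (tJoins G Set.univ A).filter (fun F => D ⊆ F), t ^ #F := by
    rw [forcing_decomposition G t (A := A) hD, symmDiff_self]
    rfl
  have htD : 0 ≤ t ^ #D := pow_nonneg ht0 _
  calc t ^ (2 * #D) * loopO1PartitionFunction G t A
      = t ^ #D * (t ^ #D * ∑ F ∈ tJoins G Set.univ A, t ^ #F) := by
        rw [IndependentStrandsJoinNegative.loopO1PartitionFunction_eq_sum_tJoins, two_mul, pow_add,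
          mul_assoc]
    _ ≤ t ^ #D * ∑ F ∈ tJoins G Set.univ ∅, t ^ #F := mul_le_mul_of_nonneg_left hxor htD
    _ ≤ t ^ #D * ((2 : ℝ) ^ #D * ∑ F ∈ tJoins G ((↑D : Set (Sym2 V))ᶜ) ∅, t ^ #F) :=
        mul_le_mul_of_nonneg_left (finite_energy G hβ D) htD
    _ = (2 : ℝ) ^ #D * (t ^ #D * ∑ F ∈ tJoins G ((↑D : Set (Sym2 V))ᶜ) ∅, t ^ #F) := by ring
    _ = (2 : ℝ) ^ #D * ∑ F ∈ (tJoins G Set.univ A).filter (fun F => D ⊆ F), t ^ #F := by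
        rw [hforce]

/-! ### Assembly on a general finite graph -/

/-- **Assembly on a general finite graph.**  If `D` is a `T`-join of `{a₂, a₃}` with `|D| ≤ m` inside
which `a₀` is joined to `a₂`, then at `t = tanh β`, `β ≥ 0`:
`(t^{2m}/2^m) · Z(a₀a₁) Z(a₂a₃) ≤ Σ_{F₁ ∈ 𝒯(a₀a₁)} Σ_{F₂ ∈ 𝒯(a₂a₃)} t^{|F₁|+|F₂|} 1[a₀ ↔ a₂ in F₁ ∪ F₂]`:
restrict the inner sum to `F₂ ⊇ D` (indicator `≡ 1`) and use the forcing cost. -/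
theorem perScale_of_forcingSet {β : ℝ} (hβ : 0 ≤ β) (a : Fin 4 → V) (m : ℕ)
    (hD : ∃ D ∈ tJoins G Set.univ {a 2, a 3}, D.card ≤ m ∧
      (SimpleGraph.fromEdgeSet (↑D : Set (Sym2 V))).Reachable (a 0) (a 2)) :
    Real.tanh β ^ (2 * m) / 2 ^ m * loopO1PartitionFunction G (Real.tanh β) {a 0, a 1} *
        loopO1PartitionFunction G (Real.tanh β) {a 2, a 3} ≤
      ∑ F₁ ∈ tJoins G Set.univ {a 0, a 1}, ∑ F₂ ∈ tJoins G Set.univ {a 2, a 3},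
        if (SimpleGraph.fromEdgeSet ((↑F₁ : Set (Sym2 V)) ∪ ↑F₂)).Reachable (a 0) (a 2)
        then Real.tanh β ^ (F₁.card + F₂.card) else 0 := by
  obtain ⟨D, hDmem, hDcard, hreach⟩ := hD
  obtain ⟨ht0, ht1⟩ := tanh_mem_Icc hβ
  have hcost := forcing_cost G hβ {a 2, a 3} hDmem
  set t := Real.tanh β with ht
  set W := ∑ F ∈ (tJoins G Set.univ {a 2, a 3}).filter (fun F => D ⊆ F), t ^ #F with hW
  have hW0 : 0 ≤ W := Finset.sum_nonneg fun F _ => pow_nonneg ht0 _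
  have hZ23 : 0 ≤ loopO1PartitionFunction G t {a 2, a 3} := loopO1PartitionFunction_nonneg G ht0 _
  have hZ01 : 0 ≤ loopO1PartitionFunction G t {a 0, a 1} := loopO1PartitionFunction_nonneg G ht0 _
  -- the forced strand: `(t^{2m}/2^m) Z(a₂a₃) ≤ W`
  have hA : t ^ (2 * m) / 2 ^ m * loopO1PartitionFunction G t {a 2, a 3} ≤ W := by
    have h1 : t ^ (2 * m) ≤ t ^ (2 * #D) := pow_le_pow_of_le_one ht0 ht1 (by omega)
    have h2 : (2 : ℝ) ^ #D ≤ 2 ^ m := pow_le_pow_right₀ one_le_two hDcard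
    have h2pos : (0 : ℝ) < 2 ^ m := by positivity
    rw [div_mul_eq_mul_div, div_le_iff₀ h2pos]
    calc t ^ (2 * m) * loopO1PartitionFunction G t {a 2, a 3}
        ≤ t ^ (2 * #D) * loopO1PartitionFunction G t {a 2, a 3} :=
          mul_le_mul_of_nonneg_right h1 hZ23
      _ ≤ 2 ^ #D * W := hcost
      _ ≤ 2 ^ m * W := mul_le_mul_of_nonneg_right h2 hW0
      _ = W * 2 ^ m := mul_comm _ _
  -- on `{F₂ ⊇ D}` the indicator is `1`
  have hreachF : ∀ F₁ F₂ : Finset (Sym2 V), D ⊆ F₂ →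
      (SimpleGraph.fromEdgeSet ((↑F₁ : Set (Sym2 V)) ∪ ↑F₂)).Reachable (a 0) (a 2) := by
    intro F₁ F₂ hDF
    refine hreach.mono (SimpleGraph.fromEdgeSet_mono ?_)
    intro e he
    exact Set.mem_union_right _ (Finset.mem_coe.2 (hDF (Finset.mem_coe.1 he)))
  calc t ^ (2 * m) / 2 ^ m * loopO1PartitionFunction G t {a 0, a 1} *
        loopO1PartitionFunction G t {a 2, a 3}
      = loopO1PartitionFunction G t {a 0, a 1} *
          (t ^ (2 * m) / 2 ^ m * loopO1PartitionFunction G t {a 2, a 3}) := by ring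
    _ ≤ loopO1PartitionFunction G t {a 0, a 1} * W := mul_le_mul_of_nonneg_left hA hZ01
    _ = ∑ F₁ ∈ tJoins G Set.univ {a 0, a 1},
          ∑ F₂ ∈ (tJoins G Set.univ {a 2, a 3}).filter (fun F => D ⊆ F), t ^ (#F₁ + #F₂) := by
        rw [IndependentStrandsJoinNegative.loopO1PartitionFunction_eq_sum_tJoins, Finset.sum_mul]
        refine Finset.sum_congr rfl fun F₁ _ => ?_
        rw [hW, Finset.mul_sum]
        refine Finset.sum_congr rfl fun F₂ _ => ?_
        rw [pow_add]
    _ ≤ _ := by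
        refine Finset.sum_le_sum fun F₁ _ => ?_
        calc ∑ F₂ ∈ (tJoins G Set.univ {a 2, a 3}).filter (fun F => D ⊆ F), t ^ (#F₁ + #F₂)
            = ∑ F₂ ∈ (tJoins G Set.univ {a 2, a 3}).filter (fun F => D ⊆ F),
                (if (SimpleGraph.fromEdgeSet ((↑F₁ : Set (Sym2 V)) ∪ ↑F₂)).Reachable (a 0) (a 2)
                  then t ^ (#F₁ + #F₂) else 0) := by
              refine Finset.sum_congr rfl fun F₂ hF₂ => ?_
              rw [if_pos (hreachF F₁ F₂ (Finset.mem_filter.1 hF₂).2)]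
          _ ≤ ∑ F₂ ∈ tJoins G Set.univ {a 2, a 3},
                (if (SimpleGraph.fromEdgeSet ((↑F₁ : Set (Sym2 V)) ∪ ↑F₂)).Reachable (a 0) (a 2)
                  then t ^ (#F₁ + #F₂) else 0) := by
              refine Finset.sum_le_sum_of_subset_of_nonneg (Finset.filter_subset _ _)
                fun F₂ _ _ => ?_
              split_ifs
              · exact pow_nonneg ht0 _
              · exact le_rfl

end StubPerScale

/-- **Auxiliary stub `stub_perScaleAssembly` of `stub_perScale` (line `pinch-to-tetra` of
`IndependentStrandsJoin`) — the general-graph assembly** (registered signature, verbatim): on every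
finite graph, for `β ≥ 0` and `t = tanh β`, if some `T`-join `D` of `{a₂, a₃}` with `|D| ≤ m` joins
`a₀` to `a₂`, then `(t^{2m}/2^m) · Z(a₀a₁) · Z(a₂a₃)` is at most the crux's double sum.  This is
`StubPerScale.perScale_of_forcingSet` (forcing cost `StubPerScale.forcing_cost` + restriction of the
inner sum to `F₂ ⊇ D`). -/
theorem stub_perScaleAssembly :
    ∀ (V : Type) [Fintype V] [DecidableEq V] (G : SimpleGraph V) [DecidableRel G.Adj] (β : ℝ),
      0 ≤ β → ∀ (a : Fin 4 → V) (m : ℕ),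
        (∃ D ∈ tJoins G Set.univ {a 2, a 3}, D.card ≤ m ∧
          (SimpleGraph.fromEdgeSet (↑D : Set (Sym2 V))).Reachable (a 0) (a 2)) →
        Real.tanh β ^ (2 * m) / 2 ^ m * loopO1PartitionFunction G (Real.tanh β) {a 0, a 1} *
            loopO1PartitionFunction G (Real.tanh β) {a 2, a 3} ≤
          ∑ F₁ ∈ tJoins G Set.univ {a 0, a 1}, ∑ F₂ ∈ tJoins G Set.univ {a 2, a 3},
            if (SimpleGraph.fromEdgeSet ((↑F₁ : Set (Sym2 V)) ∪ ↑F₂)).Reachable (a 0) (a 2)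
            then Real.tanh β ^ (F₁.card + F₂.card) else 0 :=
  fun _ _ _ G _ _ hβ a m hD => StubPerScale.perScale_of_forcingSet G hβ a m hD

end Summit.CriticalPhenomena.Ising3DConformalLimit.Theorems

end
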